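import Mathlib
import Summits.ResolutionOfSingularities.ResolutionOfSingularities.Theorems.WeightedInvariantLocalWeightedDropMonicCurveBlowup
import Summits.ResolutionOfSingularities.ResolutionOfSingularities.Theorems.WeightedInvariantLocalWeightedDropTOT2BridgePoint
import Literature.AlgebraicGeometry.Resolution.CobordantArcPersistence

/-!
# `WeightedInvariant.LocalWeightedDrop`, residual T″|₄ (skeleton v32, registered stub `stub_spaceNCRankDrop`): TOT2-LINE piece S-E2,
# (E2-c) THE COUNT-GAME BRIDGE — the CURVE MOVE `V(x_i, y)` on a dressed monic form

Crux item stmt-ResolutionOfSingularities-8899 `LocalWeightedDrop` (route `ResolutionOfSingularities/WeightedInvariant`); line TOT2-LINE v1 of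
res-L1-w43-lead-1 (`L/res-L1-w43-lead-1/g4/TOT2-LINE.md` §5 (E2-c)), dealt to res-L1-w43-stub-2 (res-L1-w43-plan-1 DEALS gen 10 #9); READ-BACK
`L/res-L1-w43-stub-2/g4/S-E2c-READBACK.md` (c2); the product trick (P) of res-L1-w43-strat-1's `CRITIQUE-TOT2-v1.md` is respected (the form `P`
below is the monic form of ANY germ — e.g. of `g = f·∏_{l∈O} x_l` — and `L` any set of letters).  [OURS · L1 W4.3, chain w43, res-L1-w43-stub-2
(gen 4).  A port of the WEIGHTED-game brick `won_monic_of_curveBlowup` (…MonicCurveBlowup: `transform_curve`, `not_X_dvd_g₀`, `constantCoeff_g₀`,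
`slice_g₀`) to the `MoveClause` of the NC COUNT GAME, companion of …TOT2BridgePoint; nothing here is a statement of any manuscript; AI-written,
gate-accepted means sorry-free with standard axioms.  Definition-free.]

THE POSITION: `b = U · P · ∏_{l ∈ L} x_l`, `P = y^d + Σ_{j<d} A_j(x') y^j` with `A_j = x_i^{d−j} · A′_j`, `A′_j(0) = 0` (`P ∈ (x_i, y)^d`: the
curve `V(x_i, y)` is permissible).  THE MOVE: blow up `V(x_i, y)` (weights `1` at `x_i` and `y`, `0` elsewhere; `Φ = X`).  THE CLAUSE
(`moveClause_curve_dressedMonic`): at every answer `pt` (`pt_l = 0` off the centre, `pt ≠ 0`) and every `s`-saturation `b∘chart(pt) = s^A·G`: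
* `γ = pt(y) ≠ 0` ⇒ at the slot `y` the successor is a unit times `s` times letters — `GermIsNC`, terminal;
* `γ = 0` (so `c_i = pt(x_i) ≠ 0`) ⇒ at the slot `x_i` the successor is AGAIN A DRESSED MONIC FORM
  `V · (y^d + Σ_j c_i^{d−j} (A′_j ∘ chart′_{e_i}(c_i))|_{i} y^j) · (s · ∏_{l∈L, pt_l = 0} x_{l↓})` — the weighted brick's successor data, so
  …PolyDescentBridgeSlices' `curveSlice_zero_eq'` / `curveSlice_one_eq'` identify it at `m = 2` with the rescaled label `A′` (`divOneT`/`divTwoT`).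
Also `moveClause_curve_of_subst_eq_dressedMonic` (a preparatory legal `Φ₀` composed in — e.g. the graph shear and re-preparation of ρ-B's case (a″)).
-/

set_option linter.dupNamespace false -- mandated namespace of this single-conjunct summit
set_option autoImplicit false

namespace Summit.ResolutionOfSingularities.ResolutionOfSingularities.Theorems

open Literature.AlgebraicGeometry.Resolution
open Literature.AlgebraicGeometry.Resolution.CobordantGame

namespace TameFourTupleDrop

open MvPowerSeries MonicCurveBlowup

variable {k : Type} [Field k] {m : ℕ}

/-! ## The transform of a dressed monic form under the curve blow-up -/

/-- The letters under the chart of weights `w ∈ {0,1}`: `x_l ↦ s^{w_l}(pt_l + y_l)`, so `∏_{l∈L} x_l ↦ s^{Σ_L w_l} · ∏_{l∈L}(pt_l + y_l)`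
(for `w_l = 0` the convention `pt_l = 0` makes the factor `y_l`). -/
theorem subst_chart_prod_X (w : Fin (m + 1) → ℕ) (pt : Fin (m + 1) → k) (hconv : ∀ l, w l = 0 → pt l = 0) (L : Finset (Fin (m + 1))) :
    subst (CobordantChart.chart w pt) (∏ l ∈ L, (X l : MvPowerSeries (Fin (m + 1)) k)) =
      X 0 ^ (∑ l ∈ L, w l) * ∏ l ∈ L, (C (pt l) + X l.succ) := by
  have hch := CobordantChart.hasSubst_chart w pt hconv
  rw [← coe_substAlgHom hch, map_prod]
  have hl : ∀ l ∈ L, substAlgHom hch (X l : MvPowerSeries (Fin (m + 1)) k) = X 0 ^ (w l) * (C (pt l) + X l.succ) := fun l _ => by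
    rw [coe_substAlgHom, subst_X hch, CobordantChart.chart_apply]
  rw [Finset.prod_congr rfl hl, Finset.prod_mul_distrib, Finset.prod_pow_eq_pow_sum]

/-- THE TOTAL TRANSFORM of `U · P · ∏_{l∈L} x_l` under the blow-up of `V(x_i, y)` at the answer `pt` (convention `pt_l = 0` off the centre):
`s^{d + Σ_L w_l} · (U∘chart · g₀ · ∏_{l∈L}(pt_l + y_l))`, `g₀ = (γ + Y)^d + Σ_j (c_i + y_i)^{d−j} · G_j · (γ + Y)^j`, `G_j = A′_j ∘ chart′`. -/
theorem transform_curve_dressedMonic {d : ℕ} (i : Fin m) (A A' : Fin d → MvPowerSeries (Fin m) k)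
    (hdiv : ∀ j, A j = X i ^ (d - (j : ℕ)) * A' j) (U : MvPowerSeries (Fin (m + 1)) k) (L : Finset (Fin (m + 1)))
    (pt : Fin (m + 1) → k) (hconv : ∀ l, (fun l : Fin (m + 1) => if l = Fin.castSucc i ∨ l = Fin.last m then (1 : ℕ) else 0) l = 0 → pt l = 0) :
    subst (CobordantChart.chart (fun l : Fin (m + 1) => if l = Fin.castSucc i ∨ l = Fin.last m then (1 : ℕ) else 0) pt)
        (U * (X (Fin.last m) ^ d + ∑ j : Fin d, rename (Fin.succAboveEmb (Fin.last m)) (A j) * X (Fin.last m) ^ (j : ℕ)) * ∏ l ∈ L, X l) =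
      X 0 ^ (d + ∑ l ∈ L, (if l = Fin.castSucc i ∨ l = Fin.last m then (1 : ℕ) else 0)) *
        (subst (CobordantChart.chart (fun l : Fin (m + 1) => if l = Fin.castSucc i ∨ l = Fin.last m then (1 : ℕ) else 0) pt) U *
          ((C (pt (Fin.last m)) + X (Fin.last (m + 1))) ^ d +
            ∑ j : Fin d, (C (pt (Fin.castSucc i)) + X (Fin.castSucc i).succ) ^ (d - (j : ℕ)) *
              rename (Fin.succAboveEmb (Fin.last (m + 1)))
                (subst (cruxChart k (fun l : Fin m => if l = i then (1 : ℕ) else 0) (fun l => pt (Fin.castSucc l))) (A' j)) *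
              (C (pt (Fin.last m)) + X (Fin.last (m + 1))) ^ (j : ℕ)) *
          ∏ l ∈ L, (C (pt l) + X l.succ)) := by
  set Wt : Fin (m + 1) → ℕ := fun l => if l = Fin.castSucc i ∨ l = Fin.last m then (1 : ℕ) else 0 with hWt
  have hch := CobordantChart.hasSubst_chart Wt pt hconv
  have hT := transform_curve i A A' hdiv pt
  have hcc : cruxChart k Wt pt = CobordantChart.chart Wt pt := CobordantArc.cruxChart_eq_chart_of_convention Wt pt hconv
  rw [hcc] at hT
  rw [← coe_substAlgHom hch, map_mul, map_mul, coe_substAlgHom, hT, subst_chart_prod_X Wt pt hconv L, pow_add]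
  ring

/-! ## The move clause -/

open scoped Classical in
/-- **(E2-c), CURVE MOVE `V(x_i, y)` — THE COUNT-GAME BRIDGE ON A DRESSED MONIC FORM.**  For `U(0) ≠ 0`, a label `A_j = x_i^{d−j}·A′_j` with
`A′_j(0) = 0`, and a set `L` of boundary letters, the blow-up of the curve `V(x_i, y)` (`Φ = X`, weights `1` at `x_i`, `y`) satisfies the
`MoveClause` with the goodness predicate «terminal (`GermIsNC`) OR again a dressed monic form»: at an answer with `γ = pt(y) ≠ 0` the successor at
the slot `y` is a unit times `s` times letters; at `γ = 0` the successor at the slot `x_i` is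
`V · (y^d + Σ_j c_i^{d−j}·(A′_j ∘ chart′_{e_i}(c_i))|_{i} · y^j) · (s · ∏_{l∈L, pt_l = 0} x_{l↓})`, `c_i = pt(x_i) ≠ 0`, `V(0) ≠ 0`. [OURS · L1 W4.3] -/
theorem moveClause_curve_dressedMonic {d : ℕ} (i : Fin m) (A A' : Fin d → MvPowerSeries (Fin m) k)
    (hdiv : ∀ j, A j = X i ^ (d - (j : ℕ)) * A' j) (hA' : ∀ j, constantCoeff (A' j) = 0)
    (U : MvPowerSeries (Fin (m + 1)) k) (hU : constantCoeff U ≠ 0) (L : Finset (Fin (m + 1))) :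
    MoveClause (U * (X (Fin.last m) ^ d + ∑ j : Fin d, rename (Fin.succAboveEmb (Fin.last m)) (A j) * X (Fin.last m) ^ (j : ℕ)) * ∏ l ∈ L, X l)
      X (fun l : Fin (m + 1) => if l = Fin.castSucc i ∨ l = Fin.last m then (1 : ℕ) else 0)
      (fun b' => GermIsNC b' ∨
        ∃ (pt : Fin (m + 1) → k) (V : MvPowerSeries (Fin (m + 1)) k),
          pt (Fin.last m) = 0 ∧ pt (Fin.castSucc i) ≠ 0 ∧ constantCoeff V ≠ 0 ∧
          b' = V * (X (Fin.last m) ^ d +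
              ∑ j : Fin d, rename (Fin.succAboveEmb (Fin.last m)) (C (pt (Fin.castSucc i) ^ (d - (j : ℕ))) * TupleGame.slice i
                (subst (CobordantChart.chart (fun l : Fin m => if l = i then (1 : ℕ) else 0)
                  (fun l : Fin m => if l = i then pt (Fin.castSucc i) else 0)) (A' j))) * X (Fin.last m) ^ (j : ℕ)) *
            (X 0 * ∏ l ∈ L.filter (fun l => pt l = 0), X (Fin.predAbove (Fin.castSucc i) l.succ))) := by
  classical
  intro pt hconv hpt0 A₀ G hfac hG
  set Wt : Fin (m + 1) → ℕ := fun l => if l = Fin.castSucc i ∨ l = Fin.last m then (1 : ℕ) else 0 with hWt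
  set w' : Fin m → ℕ := fun l => if l = i then (1 : ℕ) else 0 with hw'
  set P : MvPowerSeries (Fin (m + 1)) k := X (Fin.last m) ^ d +
    ∑ j : Fin d, rename (Fin.succAboveEmb (Fin.last m)) (A j) * X (Fin.last m) ^ (j : ℕ) with hP
  have hself : subst (X : Fin (m + 1) → MvPowerSeries (Fin (m + 1)) k) (U * P * ∏ l ∈ L, X l) = U * P * ∏ l ∈ L, X l := by
    rw [subst_self]; rfl
  rw [hself] at hfac
  -- the transform and its bracket
  set ci : k := pt (Fin.castSucc i) with hci
  set γ : k := pt (Fin.last m) with hγ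
  set Gt : Fin d → MvPowerSeries (Fin (m + 1)) k := fun j => subst (cruxChart k w' (fun l => pt (Fin.castSucc l))) (A' j) with hGt
  have hGt0 : ∀ j, constantCoeff (Gt j) = 0 := fun j => by
    rw [hGt]; dsimp only
    rw [constantCoeff_subst_of_constantCoeff_zero _ (constantCoeff_cruxChart w' _), hA' j]
  set g₀ : MvPowerSeries (Fin (m + 1 + 1)) k := (C γ + X (Fin.last (m + 1))) ^ d +
    ∑ j : Fin d, (C ci + X (Fin.castSucc i).succ) ^ (d - (j : ℕ)) * rename (Fin.succAboveEmb (Fin.last (m + 1))) (Gt j) *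
      (C γ + X (Fin.last (m + 1))) ^ (j : ℕ) with hg₀
  set Uc : MvPowerSeries (Fin (m + 1 + 1)) k := subst (CobordantChart.chart Wt pt) U with hUc
  set G₀ : MvPowerSeries (Fin (m + 1 + 1)) k := Uc * g₀ * ∏ l ∈ L, (C (pt l) + X l.succ) with hG₀
  have hT : subst (CobordantChart.chart Wt pt) (U * P * ∏ l ∈ L, X l) = X 0 ^ (d + ∑ l ∈ L, Wt l) * G₀ := by
    rw [hG₀, hUc, hg₀, hγ, hci, hP, hWt]; exact transform_curve_dressedMonic i A A' hdiv U L pt hconv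
  have hUc0 : constantCoeff Uc ≠ 0 := by
    rw [hUc, constantCoeff_subst_of_constantCoeff_zero _ (CobordantArc.constantCoeff_chart Wt pt hconv) U]; exact hU
  have hprime := MvPowerSeries.prime_X' k (0 : Fin (m + 1 + 1))
  have hG₀ndvd : ¬ X 0 ∣ G₀ := by
    intro h
    rcases hprime.dvd_or_dvd h with h | h
    · rcases hprime.dvd_or_dvd h with h | h
      · exact not_X_dvd_of_constantCoeff_ne_zero hUc0 h
      · exact not_X_dvd_g₀ i γ ci Gt (by rw [hg₀] at h; exact h)
    · obtain ⟨l, -, hl⟩ := (hprime.dvd_finsetProd_iff _).mp h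
      exact not_X_zero_dvd_C_add_X_succ (pt l) l hl
  rw [hT] at hfac
  obtain ⟨-, hGG⟩ := X_pow_mul_eq_X_pow_mul 0 hfac hG₀ndvd hG
  subst hGG
  by_cases hγ0 : γ = 0
  swap
  · -- `γ ≠ 0`: the slot `y`; terminal successor
    refine ⟨Fin.last m, hγ0, Or.inl ?_⟩
    set s₀ : Fin (m + 1) := Fin.last m with hs₀
    have hsplit : ∏ l ∈ L, TupleGame.slice s₀ (C (pt l) + X l.succ : MvPowerSeries (Fin (m + 1 + 1)) k) =
        (∏ l ∈ L.filter (fun l => pt l ≠ 0), TupleGame.slice s₀ (C (pt l) + X l.succ)) *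
          ∏ l ∈ L.filter (fun l => pt l = 0), X (Fin.predAbove s₀ l.succ) := by
      rw [← Finset.prod_filter_mul_prod_filter_not L (fun l => pt l ≠ 0)]
      congr 1
      refine Finset.prod_congr (by ext l; simp) fun l hl => ?_
      have hl0 : pt l = 0 := by simpa using (Finset.mem_filter.mp hl).2
      have hli : l ≠ s₀ := fun h => hγ0 (by rw [hγ]; exact h ▸ hl0)
      rw [hl0, map_zero, zero_add, slice_X_succ_of_ne hli]
    set W : MvPowerSeries (Fin (m + 1)) k := TupleGame.slice s₀ Uc * TupleGame.slice s₀ g₀ *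
      ∏ l ∈ L.filter (fun l => pt l ≠ 0), TupleGame.slice s₀ (C (pt l) + X l.succ) with hW
    have hW0 : constantCoeff W ≠ 0 := by
      rw [hW, map_mul, map_mul, WildTerminal.constantCoeff_slice, WildTerminal.constantCoeff_slice, hg₀,
        constantCoeff_g₀ i γ ci Gt hGt0, map_prod]
      refine mul_ne_zero (mul_ne_zero hUc0 (pow_ne_zero d hγ0)) (Finset.prod_ne_zero_iff.mpr fun l hl => ?_)
      rw [WildTerminal.constantCoeff_slice, map_add, constantCoeff_C, constantCoeff_X, add_zero]
      simpa using (Finset.mem_filter.mp hl).2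
    have heq : X 0 * TupleGame.slice s₀ G₀ = W * (X 0 * ∏ l ∈ L.filter (fun l => pt l = 0), X (Fin.predAbove s₀ l.succ)) := by
      rw [hG₀, slice_mul, slice_mul, slice_finset_prod, hsplit, hW]; ring
    rw [heq]
    exact germIsNC_unit_mul_X_zero_mul_prod_X _ _ W hW0
  · -- `γ = 0`: the slot `x_i` (`c_i ≠ 0`, every other coordinate of `pt` vanishes)
    have hci0 : ci ≠ 0 := by
      intro h0
      apply hpt0
      funext l
      by_cases h1 : l = Fin.castSucc i
      · rw [h1]; exact h0
      by_cases h2 : l = Fin.last m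
      · rw [h2]; exact hγ0
      · exact hconv l (by rw [hWt]; dsimp only; rw [if_neg (not_or.mpr ⟨h1, h2⟩)])
    set s₁ : Fin (m + 1) := Fin.castSucc i with hs₁
    refine ⟨s₁, hci0, Or.inr ⟨pt, TupleGame.slice s₁ Uc * ∏ l ∈ L.filter (fun l => pt l ≠ 0), TupleGame.slice s₁ (C (pt l) + X l.succ),
      hγ0, hci0, ?_, ?_⟩⟩
    · rw [map_mul, WildTerminal.constantCoeff_slice, map_prod]
      refine mul_ne_zero hUc0 (Finset.prod_ne_zero_iff.mpr fun l hl => ?_)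
      rw [WildTerminal.constantCoeff_slice, map_add, constantCoeff_C, constantCoeff_X, add_zero]
      simpa using (Finset.mem_filter.mp hl).2
    · have hsplit : ∏ l ∈ L, TupleGame.slice s₁ (C (pt l) + X l.succ : MvPowerSeries (Fin (m + 1 + 1)) k) =
          (∏ l ∈ L.filter (fun l => pt l ≠ 0), TupleGame.slice s₁ (C (pt l) + X l.succ)) *
            ∏ l ∈ L.filter (fun l => pt l = 0), X (Fin.predAbove s₁ l.succ) := by
        rw [← Finset.prod_filter_mul_prod_filter_not L (fun l => pt l ≠ 0)]
        congr 1
        refine Finset.prod_congr (by ext l; simp) fun l hl => ?_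
        have hl0 : pt l = 0 := by simpa using (Finset.mem_filter.mp hl).2
        have hli : l ≠ s₁ := fun h => hci0 (by rw [hci]; exact h ▸ hl0)
        rw [hl0, map_zero, zero_add, slice_X_succ_of_ne hli]
      have hchart' : cruxChart k w' (fun l => pt (Fin.castSucc l)) =
          CobordantChart.chart w' (fun l : Fin m => if l = i then ci else 0) := by
        have hc : (fun l : Fin m => if l = i then ci else 0) = fun l => if 0 < w' l then pt (Fin.castSucc l) else 0 := by
          funext l
          rw [hw']
          dsimp only
          by_cases hli : l = i
          · rw [if_pos hli, if_pos (by rw [if_pos hli]; exact one_pos), hli]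
          · rw [if_neg hli, if_neg (by rw [if_neg hli]; exact lt_irrefl 0)]
        rw [hc]
        exact CobordantChart.cruxChart_eq_chart w' _
      have hsl : TupleGame.slice s₁ g₀ = X (Fin.last m) ^ d +
          ∑ j : Fin d, rename (Fin.succAboveEmb (Fin.last m)) (C (ci ^ (d - (j : ℕ))) * TupleGame.slice i
            (subst (CobordantChart.chart w' (fun l : Fin m => if l = i then ci else 0)) (A' j))) * X (Fin.last m) ^ (j : ℕ) := by
        rw [hg₀, hγ0]
        unfold TupleGame.slice
        rw [hs₁, slice_g₀ i ci Gt]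
        simp only [hGt, hchart']
        rfl
      rw [hG₀, slice_mul, slice_mul, slice_finset_prod, hsplit, hsl, hs₁, hw']
      ring

open scoped Classical in
/-- **THE SAME WITH A PREPARATORY COORDINATE CHANGE COMPOSED IN**: if a legal `Φ₀` (zero constants) presents `b ∘ Φ₀` as a dressed monic form
with `P ∈ (x_i, y)^d` (e.g. ρ-B's case (a″): graph shear and re-preparation, then the curve `V(x₂, y)`), the move `(Φ₀, w)` satisfies the same
clause (`moveClause_subst_iff`). [OURS · L1 W4.3] -/
theorem moveClause_curve_of_subst_eq_dressedMonic {d : ℕ} (i : Fin m) (A A' : Fin d → MvPowerSeries (Fin m) k)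
    (hdiv : ∀ j, A j = X i ^ (d - (j : ℕ)) * A' j) (hA' : ∀ j, constantCoeff (A' j) = 0)
    (U : MvPowerSeries (Fin (m + 1)) k) (hU : constantCoeff U ≠ 0) (L : Finset (Fin (m + 1))) {b : MvPowerSeries (Fin (m + 1)) k}
    {Φ₀ : Fin (m + 1) → MvPowerSeries (Fin (m + 1)) k} (hΦ₀ : ∀ l, constantCoeff (Φ₀ l) = 0)
    (hb : subst Φ₀ b = U * (X (Fin.last m) ^ d + ∑ j : Fin d, rename (Fin.succAboveEmb (Fin.last m)) (A j) * X (Fin.last m) ^ (j : ℕ)) *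
      ∏ l ∈ L, X l) :
    MoveClause b Φ₀ (fun l : Fin (m + 1) => if l = Fin.castSucc i ∨ l = Fin.last m then (1 : ℕ) else 0)
      (fun b' => GermIsNC b' ∨
        ∃ (pt : Fin (m + 1) → k) (V : MvPowerSeries (Fin (m + 1)) k),
          pt (Fin.last m) = 0 ∧ pt (Fin.castSucc i) ≠ 0 ∧ constantCoeff V ≠ 0 ∧
          b' = V * (X (Fin.last m) ^ d +
              ∑ j : Fin d, rename (Fin.succAboveEmb (Fin.last m)) (C (pt (Fin.castSucc i) ^ (d - (j : ℕ))) * TupleGame.slice i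
                (subst (CobordantChart.chart (fun l : Fin m => if l = i then (1 : ℕ) else 0)
                  (fun l : Fin m => if l = i then pt (Fin.castSucc i) else 0)) (A' j))) * X (Fin.last m) ^ (j : ℕ)) *
            (X 0 * ∏ l ∈ L.filter (fun l => pt l = 0), X (Fin.predAbove (Fin.castSucc i) l.succ))) := by
  have h := moveClause_curve_dressedMonic i A A' hdiv hA' U hU L (k := k)
  rw [← hb, moveClause_subst_iff hΦ₀ (fun l => constantCoeff_X l)] at h
  have hΦ : (fun l => subst (X : Fin (m + 1) → MvPowerSeries (Fin (m + 1)) k) (Φ₀ l)) = Φ₀ := by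
    funext l; rw [subst_self]; rfl
  rwa [hΦ] at h

end TameFourTupleDrop

end Summit.ResolutionOfSingularities.ResolutionOfSingularities.Theorems
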